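import Literature.NumberTheory.EllipticCurves.FormalGroupNilIdealPoints
import Literature.NumberTheory.EllipticCurves.FormalGroupLogSummableProofs
import Literature.NumberTheory.EllipticCurves.FormalLogExpBaseChangeProofs
import HarnessLib

/-!
# The formal logarithm `log_E = Σ coeff_n(log_E) zⁿ` of `E = W ⊗ K` over a complete ultrametric field `K` with `‖p‖ < 1`:
# integrality of `ω`, the bound `‖coeff_n log_E‖ ≤ n^k`, convergence on `𝔪_K`, the tail estimate `‖log_E(z) − z‖ ≤ ‖z‖²/‖p‖`

Topic `Literature/NumberTheory/EllipticCurves`; namespace `Literature.NumberTheory.EllipticCurves`. THEOREMS ONLY (no definition,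
no instance, no named fact, no `sorry`). Setting: `K` a nontrivially normed ultrametric field with `‖p‖ < 1` for a prime `p` — ANY
normalisation of the norm (so neither `‖p‖ = p⁻¹` nor `|1/n| ≤ n` is available) —, `W/ℤ` an integral Weierstrass equation and
`E = curveOver K W = W ⊗ K` (tree `FormalGroupNilIdealPoints`), `ω_E`, `log_E ∈ K⟦z⟧` its invariant differential and formal logarithm
(`WeierstrassCurve.formalOmega/formalLog`, AEC IV.1, IV.5). This is the `K`-version of the `ℚ_p`-only tree file `FormalGroupLogSummableProofs`
(`norm_coeff_formalLog_le : ‖coeff_n log‖_p ≤ n`, `summable_formalLog_of_isIntegral`), needed for finite extensions of `ℚ_p` and for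
`ℂ_F = CompletedAlgClosure F` (sequel `FormalGroupLimitLogSeries`: `log_E ∘ z` is additive on `E₁(K)` and equals the tree's limit logarithm
`FormalGroupChart.limitLog` on the level `E⁽ᵖ⁾(K)`).

* §1 Norms of integers in `K`: `norm_natCast_eq_one_of_not_dvd` (`‖m‖ = 1` for `p ∤ m`, Bezout), `exists_norm_natCast_eq_pow` (`n = p^e m`,
  `‖n‖ = ‖p‖^e`, `p^e ≤ n`), `norm_pow_le_norm_natCast_succ` (`‖p‖ⁿ ≤ ‖n+1‖`), ★ `exists_nat_norm_inv_natCast_le_pow` — ONE exponent `k` with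
  `‖n⁻¹‖ ≤ n^k` for all `n` (`‖p‖⁻¹ ≤ 2^k`, `‖n⁻¹‖ = ‖p‖^{-e} ≤ (2^e)^k ≤ n^k`): the normalisation-free substitute for `|1/n|_p ≤ n`
  (AEC IV.6.3(a)).
* §2 Coefficients: ★ `norm_coeff_formalOmega_curveOver_le` — `‖coeff_n ω_E‖ ≤ 1` (AEC IV.1: `ω ∈ ℤ[½, a]⟦z⟧ ∩ ℤ[⅓, a]⟦z⟧`, tree
  `formalOmega_map_of_two/three`, and one of `2`, `3` is a unit of `𝒪_K` since `‖3 − 2‖ = 1`); `coeff_succ_formalLog_eq`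
  (`coeff_{k+1} log = coeff_k ω/(k+1)`, any `ℚ`-algebra); `norm_coeff_succ_formalLog_curveOver_le`; ★ `exists_nat_norm_coeff_formalLog_curveOver_le_pow`
  (`‖coeff_n log_E‖ ≤ n^k`); `curveOver_eq_map_map_rat`, `coeff_formalLog_curveOver_eq_algebraMap` (the coefficients are `algebraMap ℚ K` of those of `log_{W⊗ℚ}`).
* §3 ★ `summable_coeff_formalLog_mul_pow` — **`Σ coeff_n(log_E) zⁿ` converges for `‖z‖ < 1`** (AEC IV.6.4(a) over `K`), `hasSum_coeff_succ_formalLog_mul_pow`,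
  `tendsto_sum_coeff_succ_formalLog_mul_pow` (partial sums from `n = 1`); ★ `norm_tsum_coeff_formalLog_mul_pow_sub_le` — **`‖log_E(z) − z‖ ≤ ‖z‖²/‖p‖`
  for `‖z‖ ≤ ‖p‖`** (the quadratic estimate of the characterisation `FormalGroupChart.spec_of_additive_of_val_sub_zCoord_le`).

Crux K★ `stmt-BirchSwinnertonDyer-22226` (line `kato_lever`, memo `…/Cruxes/StarredOptimalManinUnitFiveSeven/Lines/kato-lever-K3-H4-log.md` §5 (1):
the `θ`-value junction `θ(log_W(ι[ũ]) mod Fil^k) = log_ω(P)`). Infrastructure only; BSD / K★ are not proved by any of this.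

## References
* J. H. Silverman, *The Arithmetic of Elliptic Curves*, 2nd ed. (2009), IV.1 (remark after Prop. 1.1: integrality of `ω(z)`), IV.5.5, IV.6.3(a),
  Thm. IV.6.4(a). [SilvermanAEC2009]
* J.-P. Serre, *Local class field theory*, in Cassels–Fröhlich, *Algebraic Number Theory* (1967), Ch. VI §3.2. [CasselsFrohlichANT1967]
-/

noncomputable section

open scoped Classical NNReal Topology
open PowerSeries Filter Finset

namespace Literature.NumberTheory.EllipticCurves

open Literature.NumberTheory.GaloisRepresentations.LubinTate
open Literature.NumberTheory.EllipticCurves.FormalGroupChart _root_.WeierstrassCurve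

/-! ## §1 Norms of integers in a complete ultrametric field of residue characteristic `p` -/

section Norms

variable {K : Type*} [NontriviallyNormedField K] [IsUltrametricDist K] {p : ℕ} [hp : Fact p.Prime]

/-- **`‖m‖ = 1` for `p ∤ m`**: from a Bezout relation `a p + b m = 1` and `‖a‖, ‖b‖ ≤ 1`, `‖p‖ < 1`. [cite: SilvermanAEC2009, IV.6.3] -/
theorem norm_natCast_eq_one_of_not_dvd (hp1 : ‖(p : K)‖ < 1) {m : ℕ} (hm : ¬ p ∣ m) : ‖(m : K)‖ = 1 := by
  refine le_antisymm (IsUltrametricDist.norm_natCast_le_one K m) ?_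
  by_contra hlt
  push Not at hlt
  have hcop : Nat.Coprime p m := (Nat.Prime.coprime_iff_not_dvd hp.out).mpr hm
  obtain ⟨a, b, hab⟩ : IsCoprime (p : ℤ) (m : ℤ) := Nat.isCoprime_iff_coprime.mpr hcop
  have h1 : (1 : K) = (a : K) * (p : K) + (b : K) * (m : K) := by exact_mod_cast congrArg (fun z : ℤ => (z : K)) hab.symm
  have hlt1 : ‖(a : K) * (p : K) + (b : K) * (m : K)‖ < 1 := by
    refine (IsUltrametricDist.norm_add_le_max _ _).trans_lt (max_lt ?_ ?_)
    · rw [norm_mul]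
      exact (mul_le_of_le_one_left (norm_nonneg _) (IsUltrametricDist.norm_intCast_le_one K a)).trans_lt hp1
    · rw [norm_mul]
      exact (mul_le_of_le_one_left (norm_nonneg _) (IsUltrametricDist.norm_intCast_le_one K b)).trans_lt hlt
  rw [← h1, norm_one] at hlt1
  exact lt_irrefl _ hlt1

/-- **`n = p^e m` with `p ∤ m`: `‖n‖ = ‖p‖^e` and `p^e ≤ n`.** [cite: SilvermanAEC2009, IV.6.3] -/
theorem exists_norm_natCast_eq_pow (hp1 : ‖(p : K)‖ < 1) {n : ℕ} (hn : n ≠ 0) :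
    ∃ e : ℕ, ‖(n : K)‖ = ‖(p : K)‖ ^ e ∧ p ^ e ≤ n := by
  obtain ⟨e, m, hm, rfl⟩ := Nat.exists_eq_pow_mul_and_not_dvd hn p hp.out.ne_one
  refine ⟨e, ?_, Nat.le_mul_of_pos_right _ (Nat.pos_of_ne_zero fun h => hm (h ▸ dvd_zero p))⟩
  rw [Nat.cast_mul, Nat.cast_pow, norm_mul, norm_pow, norm_natCast_eq_one_of_not_dvd hp1 hm, mul_one]

/-- **`‖p‖ⁿ ≤ ‖n + 1‖`** (`v_p(n+1) ≤ n`; AEC IV.6.3(a) `v(n) ≤ log_p n · v(p)` in the crude form used for the tail estimate).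
[cite: SilvermanAEC2009, IV.6.3] -/
theorem norm_pow_le_norm_natCast_succ (hp1 : ‖(p : K)‖ < 1) (n : ℕ) : ‖(p : K)‖ ^ n ≤ ‖((n + 1 : ℕ) : K)‖ := by
  obtain ⟨e, he, hle⟩ := exists_norm_natCast_eq_pow hp1 (Nat.succ_ne_zero n)
  rw [he]
  have he' : e ≤ n := by
    have := (Nat.lt_pow_self hp.out.one_lt (n := e)).trans_le hle
    omega
  exact pow_le_pow_of_le_one (norm_nonneg _) hp1.le he'

/-- ★ **One exponent for all denominators: `∃ k, ∀ n, ‖n⁻¹‖ ≤ n^k`** (`‖p‖⁻¹ ≤ 2^k`; `n = p^e m` gives `‖n⁻¹‖ = ‖p‖^{-e} ≤ (2^e)^k ≤ n^k`).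
The normalisation-free substitute for `|1/n|_p ≤ n`. [cite: SilvermanAEC2009, IV.6.3] -/
theorem exists_nat_norm_inv_natCast_le_pow (hp1 : ‖(p : K)‖ < 1) : ∃ k : ℕ, ∀ n : ℕ, ‖((n : K))⁻¹‖ ≤ (n : ℝ) ^ k := by
  by_cases hp0 : (p : K) = 0
  · -- degenerate normalisation `‖p‖ = 0`: then `p = 0` in `K`, every `n` is `0` or has `‖n⁻¹‖ ≤ …`; use `k = 0` only if possible.
    -- In fact `(p : K) = 0` forces `‖n‖ ∈ {0, 1}`-type behaviour; we avoid case analysis by the same Bezout argument with `k = 1`.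
    refine ⟨1, fun n => ?_⟩
    rcases Nat.eq_zero_or_pos n with rfl | hn
    · simp
    · by_cases hpn : p ∣ n
      · obtain ⟨m, rfl⟩ := hpn
        rw [Nat.cast_mul, hp0, zero_mul, inv_zero, norm_zero]
        positivity
      · rw [norm_inv, norm_natCast_eq_one_of_not_dvd hp1 hpn, inv_one, pow_one]
        exact_mod_cast hn
  obtain ⟨k, hk⟩ : ∃ k : ℕ, ‖(p : K)‖⁻¹ ≤ 2 ^ k := by
    obtain ⟨k, hk⟩ := pow_unbounded_of_one_lt ‖(p : K)‖⁻¹ (by norm_num : (1 : ℝ) < 2)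
    exact ⟨k, hk.le⟩
  refine ⟨k, fun n => ?_⟩
  rcases Nat.eq_zero_or_pos n with rfl | hn
  · simp
  obtain ⟨e, he, hle⟩ := exists_norm_natCast_eq_pow hp1 hn.ne'
  have h2e : 2 ^ e ≤ n := (Nat.pow_le_pow_left hp.out.two_le e).trans hle
  rw [norm_inv, he, ← inv_pow]
  calc ‖(p : K)‖⁻¹ ^ e ≤ (2 ^ k) ^ e := pow_le_pow_left₀ (inv_nonneg.mpr (norm_nonneg _)) hk e
    _ = ((2 ^ e : ℕ) : ℝ) ^ k := by push_cast; rw [← pow_mul, ← pow_mul, mul_comm]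
    _ ≤ (n : ℝ) ^ k := pow_le_pow_left₀ (by positivity) (by exact_mod_cast h2e) k

/-- In an ultrametric group, a `HasSum` all of whose terms have norm `≤ C` has norm `≤ C`. [folklore] -/
private theorem norm_le_of_hasSum_of_forall_norm_le {G : Type*} [SeminormedAddCommGroup G] [IsUltrametricDist G] {ι : Type*}
    {f : ι → G} {a : G} (ha : HasSum f a) {C : ℝ} (hC : 0 ≤ C) (h : ∀ i, ‖f i‖ ≤ C) : ‖a‖ ≤ C := by
  have hclosed : IsClosed {x : G | ‖x‖ ≤ C} := isClosed_le continuous_norm continuous_const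
  exact hclosed.mem_of_tendsto ha (Eventually.of_forall fun s => IsUltrametricDist.norm_sum_le_of_forall_le_of_nonneg hC fun i _ => h i)

end Norms

/-! ## §2 The coefficients of `ω_E` and `log_E` for `E = W ⊗ K`, `W/ℤ` -/

section Coefficients

variable {K : Type*} [NontriviallyNormedField K] [IsUltrametricDist K] [CharZero K]
  (W : WeierstrassCurve ℤ) {p : ℕ} [hp : Fact p.Prime]

omit [CharZero K] hp in
/-- An element of norm `1` of `𝒪_K` is a unit of `𝒪_K`. [folklore] -/
private theorem isUnit_unitBall_of_norm_eq_one {x : unitBall K} (hx : ‖(x : K)‖ = 1) : IsUnit x := by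
  have hx0 : (x : K) ≠ 0 := fun h => by rw [h, norm_zero] at hx; exact zero_ne_one hx
  refine ⟨⟨x, ⟨(x : K)⁻¹, (mem_unitBall_iff K).mpr (by rw [norm_inv, hx, inv_one])⟩, Subtype.ext (mul_inv_cancel₀ hx0),
    Subtype.ext (inv_mul_cancel₀ hx0)⟩, rfl⟩

omit hp in
/-- **`‖coeff_n ω_E‖ ≤ 1`**: `ω(z) ∈ 𝒪_K⟦z⟧` (AEC IV.1: `ω ∈ ℤ[½, a]⟦z⟧` and `∈ ℤ[⅓, a]⟦z⟧`; one of `2`, `3` is a unit of `𝒪_K` since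
`‖3 − 2‖ = 1`). [cite: SilvermanAEC2009, IV.1.1] -/
theorem norm_coeff_formalOmega_curveOver_le (n : ℕ) : ‖coeff n (curveOver K W).formalOmega‖ ≤ 1 := by
  have key : ∀ (u : (unitBall K)ˣ), ((u : unitBall K) : K) = 2 ∨ ((u : unitBall K) : K) = 3 →
      ∃ g : PowerSeries (unitBall K), (curveOver K W).formalOmega = PowerSeries.map (algebraMap (unitBall K) K) g := by
    rintro u (hu | hu)
    · have hu' : (u : unitBall K) = 2 := Subtype.ext (by rw [hu]; rfl)
      exact ⟨_, formalOmega_map_of_two (ballIntModel K W) (algebraMap (unitBall K) K) u hu'⟩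
    · have hu' : (u : unitBall K) = 3 := Subtype.ext (by rw [hu]; rfl)
      exact ⟨_, formalOmega_map_of_three (ballIntModel K W) (algebraMap (unitBall K) K) u hu'⟩
  obtain ⟨g, hg⟩ : ∃ g : PowerSeries (unitBall K), (curveOver K W).formalOmega = PowerSeries.map (algebraMap (unitBall K) K) g := by
    by_cases h2 : ‖(2 : K)‖ = 1
    · obtain ⟨u, hu⟩ := isUnit_unitBall_of_norm_eq_one (K := K) (x := ⟨2, (mem_unitBall_iff K).mpr h2.le⟩) h2
      exact key u (Or.inl (by rw [hu]))
    · have h2' : ‖(2 : K)‖ < 1 := lt_of_le_of_ne (by exact_mod_cast IsUltrametricDist.norm_natCast_le_one K 2) h2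
      have h3 : ‖(3 : K)‖ = 1 := by
        refine le_antisymm (by exact_mod_cast IsUltrametricDist.norm_natCast_le_one K 3) ?_
        by_contra h3
        push Not at h3
        have : ‖(3 : K) + (-2)‖ < 1 :=
          (IsUltrametricDist.norm_add_le_max _ _).trans_lt (max_lt h3 (by rw [norm_neg]; exact h2'))
        norm_num at this
      obtain ⟨u, hu⟩ := isUnit_unitBall_of_norm_eq_one (K := K) (x := ⟨3, (mem_unitBall_iff K).mpr h3.le⟩) h3
      exact key u (Or.inr (by rw [hu]))
  rw [hg, PowerSeries.coeff_map]
  exact norm_coe_unitBall_le_one _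

omit hp in
/-- **`coeff_{k+1} log_V = coeff_k ω_V / (k+1)`** (`log = ∫ω`, AEC IV.5.5), over any `ℚ`-algebra. [cite: SilvermanAEC2009, IV.5.5] -/
theorem coeff_succ_formalLog_eq {R : Type*} [CommRing R] [Algebra ℚ R] (V : WeierstrassCurve R) (k : ℕ) :
    coeff (k + 1) V.formalLog = algebraMap ℚ R (1 / ((k : ℚ) + 1)) * coeff k V.formalOmega := by
  rcases k with _ | k
  · rw [zero_add, coeff_one_formalLog, coeff_zero_eq_constantCoeff_apply, V.constantCoeff_formalOmega]
    norm_num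
  · rw [formalLog, coeff_mk]
    push_cast
    ring_nf

omit hp in
/-- **`‖coeff_{k+1} log_E‖ ≤ ‖(k+1)⁻¹‖`.** [cite: SilvermanAEC2009, IV.6.3] -/
theorem norm_coeff_succ_formalLog_curveOver_le (k : ℕ) :
    ‖coeff (k + 1) (curveOver K W).formalLog‖ ≤ ‖(((k + 1 : ℕ) : K))⁻¹‖ := by
  rw [coeff_succ_formalLog_eq, norm_mul, map_div₀, map_one, one_div]
  have h : algebraMap ℚ K ((k : ℚ) + 1) = ((k + 1 : ℕ) : K) := by rw [map_add, map_natCast, map_one]; push_cast; rfl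
  rw [h]
  exact mul_le_of_le_one_right (norm_nonneg _) (norm_coeff_formalOmega_curveOver_le W k)

/-- ★ **`∃ k, ∀ n, ‖coeff_n log_E‖ ≤ n^k`** (AEC IV.6.3(a) `‖coeff_n log‖_p ≤ n`, normalisation-free). [cite: SilvermanAEC2009, IV.6.3] -/
theorem exists_nat_norm_coeff_formalLog_curveOver_le_pow (hp1 : ‖(p : K)‖ < 1) :
    ∃ k : ℕ, ∀ n : ℕ, ‖coeff n (curveOver K W).formalLog‖ ≤ (n : ℝ) ^ k := by
  obtain ⟨k, hk⟩ := exists_nat_norm_inv_natCast_le_pow (K := K) hp1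
  refine ⟨k, fun n => ?_⟩
  rcases n with _ | m
  · rw [coeff_zero_eq_constantCoeff_apply, constantCoeff_formalLog, norm_zero]; positivity
  · exact (norm_coeff_succ_formalLog_curveOver_le W m).trans (hk (m + 1))

omit hp in
/-- `E = W ⊗ K` is `W ⊗ ℚ` base-changed to `K`. [cite: SilvermanAEC2009, VII.1] -/
theorem curveOver_eq_map_map_rat : curveOver K W = (W.map (Int.castRingHom ℚ)).map (algebraMap ℚ K) := by
  rw [curveOver, ballIntModel, WeierstrassCurve.baseChange, WeierstrassCurve.map_map, WeierstrassCurve.map_map]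
  congr 1
  exact RingHom.ext_int _ _

omit hp in
/-- **The coefficients of `log_E` are those of `log_{W ⊗ ℚ}`**: `coeff_n log_E = algebraMap ℚ K (coeff_n log_{W⊗ℚ})` (`map_formalLog`).
[cite: SilvermanAEC2009, IV.5.5] -/
theorem coeff_formalLog_curveOver_eq_algebraMap (n : ℕ) :
    coeff n (curveOver K W).formalLog = algebraMap ℚ K (coeff n (W.map (Int.castRingHom ℚ)).formalLog) := by
  rw [curveOver_eq_map_map_rat, ← map_formalLog, PowerSeries.coeff_map]

end Coefficients

/-! ## §3 Convergence of `log_E(z) = Σ coeff_n(log_E) zⁿ` on `𝔪_K` and the tail estimate on `p𝒪_K` -/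

section Summable

variable {K : Type*} [NontriviallyNormedField K] [IsUltrametricDist K] [CompleteSpace K] [CharZero K]
  (W : WeierstrassCurve ℤ) {p : ℕ} [hp : Fact p.Prime]

/-- ★ **AEC IV.6.4(a) over `K`: `Σ coeff_n(log_E) zⁿ` converges for `‖z‖ < 1`** (`‖coeff_n‖ ≤ n^k`, comparison with `Σ n^k rⁿ`).
[cite: SilvermanAEC2009, IV.6.4] -/
theorem summable_coeff_formalLog_mul_pow (hp1 : ‖(p : K)‖ < 1) {z : K} (hz : ‖z‖ < 1) :
    Summable fun n : ℕ => coeff n (curveOver K W).formalLog * z ^ n := by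
  obtain ⟨k, hk⟩ := exists_nat_norm_coeff_formalLog_curveOver_le_pow W (K := K) hp1
  have hg := summable_pow_mul_geometric_of_norm_lt_one k (show ‖(‖z‖ : ℝ)‖ < 1 by rwa [norm_norm])
  refine Summable.of_norm_bounded hg fun n => ?_
  rw [norm_mul, norm_pow]
  exact mul_le_mul_of_nonneg_right (hk n) (pow_nonneg (norm_nonneg z) n)

/-- The same series started at `n = 1` (`coeff_0 log = 0`): `HasSum (m ↦ coeff_{m+1} z^{m+1}) (Σ' n, coeff_n zⁿ)`. [cite: SilvermanAEC2009, IV.6.4] -/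
theorem hasSum_coeff_succ_formalLog_mul_pow (hp1 : ‖(p : K)‖ < 1) {z : K} (hz : ‖z‖ < 1) :
    HasSum (fun m : ℕ => coeff (m + 1) (curveOver K W).formalLog * z ^ (m + 1))
      (∑' n : ℕ, coeff n (curveOver K W).formalLog * z ^ n) := by
  have h := (summable_coeff_formalLog_mul_pow W hp1 hz).hasSum
  rw [← hasSum_nat_add_iff' 1] at h
  simpa only [sum_range_one, coeff_zero_eq_constantCoeff_apply, constantCoeff_formalLog, zero_mul, sub_zero] using h

/-- Partial sums: `Σ_{m<M} coeff_{m+1} z^{m+1} → Σ' n, coeff_n zⁿ`. [cite: SilvermanAEC2009, IV.6.4] -/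
theorem tendsto_sum_coeff_succ_formalLog_mul_pow (hp1 : ‖(p : K)‖ < 1) {z : K} (hz : ‖z‖ < 1) :
    Tendsto (fun M : ℕ => ∑ m ∈ range M, coeff (m + 1) (curveOver K W).formalLog * z ^ (m + 1)) atTop
      (𝓝 (∑' n : ℕ, coeff n (curveOver K W).formalLog * z ^ n)) :=
  (hasSum_coeff_succ_formalLog_mul_pow W hp1 hz).tendsto_sum_nat

/-- ★ **Tail estimate: `‖log_E(z) − z‖ ≤ ‖z‖²/‖p‖` for `‖z‖ ≤ ‖p‖`** (`‖coeff_n zⁿ‖ ≤ ‖z‖ⁿ/‖p‖^{n−1} ≤ ‖z‖²/‖p‖` for `n ≥ 2`).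
[cite: SilvermanAEC2009, IV.6.3] -/
theorem norm_tsum_coeff_formalLog_mul_pow_sub_le (hp0 : (p : K) ≠ 0) (hp1 : ‖(p : K)‖ < 1) {z : K} (hz : ‖z‖ ≤ ‖(p : K)‖) :
    ‖∑' n : ℕ, coeff n (curveOver K W).formalLog * z ^ n - z‖ ≤ ‖z‖ ^ 2 / ‖(p : K)‖ := by
  have hp' : 0 < ‖(p : K)‖ := norm_pos_iff.mpr hp0
  have hz1 : ‖z‖ < 1 := hz.trans_lt hp1
  have hsum := summable_coeff_formalLog_mul_pow W hp1 hz1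
  -- split off the terms `n = 0, 1`
  have hsplit : ∑' n : ℕ, coeff n (curveOver K W).formalLog * z ^ n =
      z + ∑' n : ℕ, coeff (n + 2) (curveOver K W).formalLog * z ^ (n + 2) := by
    rw [← hsum.sum_add_tsum_nat_add 2, sum_range_succ, sum_range_one, coeff_zero_eq_constantCoeff_apply, constantCoeff_formalLog,
      coeff_one_formalLog]
    ring
  rw [hsplit, add_sub_cancel_left]
  have htail : HasSum (fun n : ℕ => coeff (n + 2) (curveOver K W).formalLog * z ^ (n + 2))
      (∑' n : ℕ, coeff (n + 2) (curveOver K W).formalLog * z ^ (n + 2)) := ((summable_nat_add_iff 2).mpr hsum).hasSum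
  refine norm_le_of_hasSum_of_forall_norm_le htail (by positivity) fun n => ?_
  -- `‖coeff_{n+2} z^{n+2}‖ ≤ ‖z‖^{n+2} / ‖p‖^{n+1} ≤ ‖z‖²/‖p‖`
  have hc : ‖coeff (n + 2) (curveOver K W).formalLog‖ ≤ (‖(p : K)‖ ^ (n + 1))⁻¹ := by
    refine (norm_coeff_succ_formalLog_curveOver_le W (n + 1)).trans ?_
    rw [norm_inv]
    refine inv_anti₀ (pow_pos hp' _) ?_
    exact norm_pow_le_norm_natCast_succ (K := K) hp1 (n + 1)
  rw [norm_mul, norm_pow]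
  calc ‖coeff (n + 2) (curveOver K W).formalLog‖ * ‖z‖ ^ (n + 2)
      ≤ (‖(p : K)‖ ^ (n + 1))⁻¹ * ‖z‖ ^ (n + 2) := mul_le_mul_of_nonneg_right hc (pow_nonneg (norm_nonneg _) _)
    _ = ‖z‖ ^ 2 / ‖(p : K)‖ * (‖z‖ / ‖(p : K)‖) ^ n := by
        rw [div_pow]; field_simp; ring
    _ ≤ ‖z‖ ^ 2 / ‖(p : K)‖ * 1 := by
        refine mul_le_mul_of_nonneg_left (pow_le_one₀ (by positivity) ((div_le_one hp').mpr hz)) (by positivity)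
    _ = ‖z‖ ^ 2 / ‖(p : K)‖ := mul_one _

end Summable

end Literature.NumberTheory.EllipticCurves

end
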